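import Literature.Geometry.Kaehler.ComplexTorusMixedHodgeRiemannTimorin
import HarnessLib

/-!
# Dinh–Nguyên's Proposition 2.2 on a complex torus: the norm estimate
# `‖α‖² ≤ C₁ ‖α ∧ Ω ∧ ω‖² + C₂ Re Q(α, α)` on `Λ^{p,q}`, in every bidegree

Layer `Literature/Geometry/Kaehler`, namespace `Literature.Geometry.Kaehler.ComplexTorus`; lane `lit-hodgefound`
(Track 2, HodgeConjecture), seat p16, generation 25 (row g25-#2); sequel of T4b `ComplexTorusMixedHodgeRiemannTimorin`
(Timorin's theorem: mixed Hodge–Riemann and mixed hard Lefschetz in every bidegree) and of g25-#1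
`ComplexTorusMixedHodgeIndexAllBidegrees`. Everything here is PROVED: theorems only, no definition, no named fact.

**Proposition 2.2 of Dinh–Nguyên (2006)** — "The following estimate will be crucial later on" (it drives their
`dd^c`-lemma, Prop. 2.3, hence Theorems A–C for compact Kähler manifolds) — in the linear context of a complex torus
`X = E/Φ(ℤ^ι)` of dimension `g = n + p + q` with positive real `(1,1)`-forms `θ_0, …, θ_n` (Kähler forms `ω_j = -θ_j`):
there are `C₁, C₂ > 0` with

  `‖A‖² ≤ C₁ ‖(-θ_0)_ℂ ∧ ⋯ ∧ (-θ_n)_ℂ ∧ A‖² + C₂ · Re(ε(k,p,q) ∫_X (-θ_0)_ℂ ∧ ⋯ ∧ (-θ_{n-1})_ℂ ∧ A ∧ Ā)`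

for all forms `A` of type `(p, q)` (`exists_norm_sq_le_of_pos`; `k = p + q`, `ε(k,p,q) = (-1)^{k(k-1)/2} i^{p-q}` the
sign of T4a, norms = the operator norms of the tree on constant forms; any two norms on the finite-dimensional
`Λ^{p,q}` being equivalent, the choice only changes the constants).

Proof. Dinh–Nguyên decompose `α = β + ω ∧ γ` (Prop. 2.1 (c)), use the two-sided estimate
`‖γ‖/C ≤ ‖γ ∧ Ω ∧ ω²‖ ≤ C ‖γ‖` (Prop. 2.1 (a)) and `‖β‖² ≤ C'' Q(β, β)` (Prop. 2.1 (b)). We take the genuinely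
shorter road through ONE compactness argument (§1, the coordinate-free Finsler–Debreu lemma on a finite-dimensional
real normed space): if a real bilinear form `B` is positive on `ker L ∖ 0` then `‖x‖² ≤ C₁ ‖Lx‖² + C₂ B(x,x)` —
applied to `L = Ω_{n+1} ∧ ·` on `Λ^{p,q}` and `B = h` (positive on the mixed primitive forms by Timorin's theorem,
T4b). §2 records the quantitative mixed hard Lefschetz bound `‖A‖² ≤ C ‖Ω ∧ A‖²` (the lower half of (2.0); the
upper half is the operator-norm bound of `∧`), §3 the proposition, its primitive case ("coercivity of `Q` on
`P^{p,q}`") and the form with the complex pairing `H(A, A)`.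

## Sources (held copies read; locators are arXiv PDF pages / chunks)

* T.-C. Dinh, V.-A. Nguyên, *The mixed Hodge–Riemann bilinear relations for compact Kähler manifolds*, GAFA 16
  (2006) 838–849 [DinhNguyen2006] (held `paper:arxiv-math_0501449`), p. 5 (chunk p0005 L48–L58): "The following
  estimate will be crucial later on. **Proposition 2.2.** There are finite positive constants `C₁` and `C₂` such that
  `C₁ · ‖α ∧ Ω ∧ ω_{n-p-q+1}‖² + C₂ · Re Q(α, α) ≥ ‖α‖²` for all forms `α ∈ Λ^{p,q}(ℂⁿ)`." with its proof (L59–L118: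
  (2.0) "`‖γ‖/C ≤ ‖γ ∧ Ω ∧ ω²_{n-p-q+1}‖ ≤ C · ‖γ‖`", the decomposition `α = β + ω_{n-p-q+1} ∧ γ`,
  "`‖β‖² ≤ C'' · Q(β, β)`", "`C₁ := C'C''` and `C₂ := C'C''C⁴ + C'C²`"); p. 5 Prop. 2.1 (a)–(c); p. 6 (chunk p0006)
  Prop. 2.3 (the use: "one next invokes the estimate in Proposition 2.2 for every point").
* V. A. Timorin, *Mixed Hodge–Riemann bilinear relations in a linear context*, Funct. Anal. Appl. 32 (1998) 268–272
  [Timorin1998] — Main Theorem (through T4b).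
* P. Finsler, *Über das Vorkommen definiter und semidefiniter Formen in Scharen quadratischer Formen*, Comment.
  Math. Helv. 9 (1937) 188–192 [Finsler1937] (the pencil lemma; the tree's matrix form is
  `Literature/Analysis/Convexity/FinslerLemma.lean`, not imported here — §1 is the coordinate-free normed-space form
  with the coercivity constant, proved directly by Cantor's intersection theorem on the unit sphere).
* J. Gregory, *Quadratic Form Theory and Differential Equations* (1980) [Gregory1980QuadraticForms], Ch. 2 §2.3
  (continuity of quadratic forms in finite dimension; "choose `M < 0` and `δ > 0`" compactness step of Thm. 5;
  chunks p0085–p0086).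
* F. W. Warner, *Foundations of Differentiable Manifolds and Lie Groups*, GTM 94, 2.6 (`∧` bilinear and bounded).
  [WarnerGTM94]
-/

noncomputable section

set_option maxSynthPendingDepth 3

open scoped ComplexConjugate ComplexOrder Topology
open Complex Function Module Filter
open Literature.LinearAlgebra.Alternating
open Literature.Analysis.Complex (typeSubmodule isOfTypeAt_of_mem_typeSubmodule)
open Literature.NumberTheory.Transcendental (wedgeCLM wedgeCLM_apply)

namespace Literature.Geometry.Kaehler

namespace ComplexTorus

universe u

/-! ## §1 The compactness lemma (Finsler–Debreu) on a finite-dimensional real normed space -/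

section Finsler

variable {V W : Type*} [NormedAddCommGroup V] [NormedSpace ℝ V] [FiniteDimensional ℝ V]
  [NormedAddCommGroup W] [NormedSpace ℝ W]

/-- On a finite-dimensional real normed space every bilinear form has a continuous diagonal `x ↦ B(x, x)`.
[cite: Gregory1980QuadraticForms, Ch. 2 §2.3 (continuity hypotheses (1), (2); chunk p0085)] -/
theorem continuous_bilinForm_apply_self (B : LinearMap.BilinForm ℝ V) : Continuous fun x ↦ B x x := by
  let Bc : V →L[ℝ] (V →L[ℝ] ℝ) :=
    LinearMap.toContinuousLinearMap
      ((LinearMap.toContinuousLinearMap : (V →ₗ[ℝ] ℝ) ≃ₗ[ℝ] (V →L[ℝ] ℝ)).toLinearMap ∘ₗ B)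
  have hBc : ∀ x y, Bc x y = B x y := fun x y ↦ by simp [Bc]
  exact (Bc.continuous₂.comp (continuous_id.prodMk continuous_id)).congr fun x ↦ hBc x x

/-- **Compactness lemma (Finsler 1937 / Debreu 1952, coordinate-free, on a finite-dimensional real normed space).**
If a real bilinear form `B` satisfies `B(x, x) > 0` for every non-zero `x` in the kernel of a linear map `L`, then
for suitable constants `C₁, C₂ > 0`: **`‖x‖² ≤ C₁ ‖L x‖² + C₂ B(x, x)` for all `x`** (equivalently `B + C‖L·‖²` is
positive definite and coercive for `C` large). Proof: on the unit sphere `S` some `g_m = B(x,x) + m‖Lx‖²`, `m ∈ ℕ`,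
is positive — otherwise the compact sets `{x ∈ S : g_m(x) ≤ 0}` decrease and are non-empty, so (Cantor) they share
a point `x`, which has `L x = 0` and `B(x, x) ≤ 0`; a positive continuous function on the compact `S` is bounded
below by some `δ > 0`; homogeneity. This replaces the two norm-equivalence constants of Dinh–Nguyên's proof of
Prop. 2.2 by one compactness argument. [cite: DinhNguyen2006, §2 Prop. 2.2 (proof) (arXiv PDF p. 5)]
[cite: Finsler1937, pp. 188–192] [cite: Gregory1980QuadraticForms, Ch. 2 §2.3 Thm. 5 (proof: "we may choose `M < 0` and `δ > 0`"; chunk p0086)] -/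
theorem exists_norm_sq_le_of_pos_on_ker (B : LinearMap.BilinForm ℝ V) (L : V →ₗ[ℝ] W)
    (hpos : ∀ x, L x = 0 → x ≠ 0 → 0 < B x x) :
    ∃ C₁ C₂ : ℝ, 0 < C₁ ∧ 0 < C₂ ∧ ∀ x, ‖x‖ ^ 2 ≤ C₁ * ‖L x‖ ^ 2 + C₂ * B x x := by
  have hB : Continuous fun x ↦ B x x := continuous_bilinForm_apply_self B
  have hL : Continuous L := L.continuous_of_finiteDimensional
  set S : Set V := Metric.sphere (0 : V) 1 with hS
  have hSc : IsCompact S := isCompact_sphere 0 1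
  have hg : ∀ m : ℕ, Continuous fun x ↦ B x x + m * ‖L x‖ ^ 2 := fun m ↦
    hB.add (continuous_const.mul ((continuous_norm.comp hL).pow 2))
  -- (1) some `g_m` is positive on the sphere
  have h1 : ∃ m : ℕ, ∀ x ∈ S, 0 < B x x + m * ‖L x‖ ^ 2 := by
    by_contra hcon
    simp only [not_exists, not_forall, not_lt] at hcon
    set A : ℕ → Set V := fun m ↦ {x | x ∈ S ∧ B x x + m * ‖L x‖ ^ 2 ≤ 0} with hA
    have hAd : ∀ m, A (m + 1) ⊆ A m := by
      intro m x hx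
      refine ⟨hx.1, le_trans ?_ hx.2⟩
      push_cast
      nlinarith [sq_nonneg ‖L x‖]
    have hAn : ∀ m, (A m).Nonempty := fun m ↦ by
      obtain ⟨x, hxS, hx⟩ := hcon m
      exact ⟨x, hxS, hx⟩
    have hAcl : ∀ m, IsClosed (A m) := fun m ↦
      Metric.isClosed_sphere.inter (isClosed_le (hg m) continuous_const)
    have hA0 : IsCompact (A 0) := hSc.of_isClosed_subset (hAcl 0) fun x hx ↦ hx.1
    obtain ⟨x, hx⟩ := IsCompact.nonempty_iInter_of_sequence_nonempty_isCompact_isClosed A hAd hAn hA0 hAcl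
    rw [Set.mem_iInter] at hx
    have hxS : x ∈ S := (hx 0).1
    have hx0 : x ≠ 0 := by
      intro h
      rw [h, hS, mem_sphere_zero_iff_norm, norm_zero] at hxS
      exact zero_ne_one hxS
    have hB0 : B x x ≤ 0 := by
      have h := (hx 0).2
      simpa using h
    have hLx : L x = 0 := by
      by_contra hne
      have hpos' : 0 < ‖L x‖ ^ 2 := by positivity
      obtain ⟨m, hm⟩ := exists_nat_gt (-B x x / ‖L x‖ ^ 2)
      have h := (hx m).2
      rw [div_lt_iff₀ hpos'] at hm
      linarith
    exact absurd (hpos x hLx hx0) (not_lt.2 hB0)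
  obtain ⟨m, hm⟩ := h1
  -- (2) a positive lower bound on the sphere
  have h2 : ∃ δ : ℝ, 0 < δ ∧ ∀ x ∈ S, δ ≤ B x x + m * ‖L x‖ ^ 2 := by
    rcases S.eq_empty_or_nonempty with hSe | hSne
    · exact ⟨1, one_pos, fun x hx ↦ by simp [hSe] at hx⟩
    · obtain ⟨x₀, hx₀S, hmin⟩ := hSc.exists_isMinOn hSne (hg m).continuousOn
      exact ⟨_, hm x₀ hx₀S, fun x hx ↦ hmin hx⟩
  obtain ⟨δ, hδ, hδle⟩ := h2
  -- (3) homogeneity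
  refine ⟨(m + 1) / δ, 1 / δ, by positivity, by positivity, fun x ↦ ?_⟩
  rcases eq_or_ne x 0 with rfl | hx0
  · simp
  have hnx : 0 < ‖x‖ := norm_pos_iff.2 hx0
  set c : ℝ := ‖x‖⁻¹ with hc
  have hcx : c • x ∈ S := by
    rw [hS, mem_sphere_zero_iff_norm, hc, norm_smul, norm_inv, norm_norm, inv_mul_cancel₀ hnx.ne']
  have h := hδle _ hcx
  have hBc : B (c • x) (c • x) = c ^ 2 * B x x := by
    simp only [map_smul, LinearMap.smul_apply, smul_eq_mul]
    ring
  have hLc : ‖L (c • x)‖ ^ 2 = c ^ 2 * ‖L x‖ ^ 2 := by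
    rw [map_smul, norm_smul, mul_pow, hc, norm_inv, norm_norm]
  rw [hBc, hLc] at h
  have hc2 : c ^ 2 * ‖x‖ ^ 2 = 1 := by
    rw [hc, ← mul_pow, inv_mul_cancel₀ hnx.ne', one_pow]
  -- `δ ‖x‖² ≤ B x x + m ‖L x‖²`
  have key : δ * ‖x‖ ^ 2 ≤ B x x + m * ‖L x‖ ^ 2 := by
    have h' := mul_le_mul_of_nonneg_right h (sq_nonneg ‖x‖)
    have hrw : (c ^ 2 * B x x + m * (c ^ 2 * ‖L x‖ ^ 2)) * ‖x‖ ^ 2 =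
        (B x x + m * ‖L x‖ ^ 2) * (c ^ 2 * ‖x‖ ^ 2) := by ring
    rw [hrw, hc2, mul_one] at h'
    exact h'
  rw [div_mul_eq_mul_div, div_mul_eq_mul_div, one_mul, ← add_div, le_div_iff₀ hδ]
  nlinarith [sq_nonneg ‖L x‖, key]

/-- The same with `B = 0`: **an injective linear map on a finite-dimensional normed space is bounded below**,
`‖x‖² ≤ C ‖L x‖²`. [cite: DinhNguyen2006, §2 Prop. 2.2 (proof, estimate (2.0)) (arXiv PDF p. 5)] -/
theorem exists_norm_sq_le_of_ker_eq_bot (L : V →ₗ[ℝ] W) (hL : ∀ x, L x = 0 → x = 0) :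
    ∃ C : ℝ, 0 < C ∧ ∀ x, ‖x‖ ^ 2 ≤ C * ‖L x‖ ^ 2 := by
  obtain ⟨C₁, C₂, hC₁, -, h⟩ := exists_norm_sq_le_of_pos_on_ker (0 : LinearMap.BilinForm ℝ V) L
    (fun x hx hx0 ↦ absurd (hL x hx) hx0)
  exact ⟨C₁, hC₁, fun x ↦ by simpa using h x⟩

end Finsler

/-! ## §2 Quantitative mixed hard Lefschetz: `‖A‖ ≤ C ‖Ω ∧ A‖` on `Λ^{p,q}` -/

section HardLefschetz

variable {E : Type u} [NormedAddCommGroup E] [NormedSpace ℂ E] [FiniteDimensional ℂ E]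

/-- **Quantitative mixed hard Lefschetz** (Dinh–Nguyên's estimate (2.0), lower half: "`‖γ‖ / C ≤ ‖γ ∧ Ω ∧ ω²‖`"):
for positive real `(1,1)`-forms `θ_1, …, θ_r` on `E` with `dim_ℂ E = r + p + q` there is `C > 0` with
`‖A‖² ≤ C ‖(-θ_1)_ℂ ∧ ⋯ ∧ (-θ_r)_ℂ ∧ A‖²` for every form `A` of type `(p, q)` — the injective operator of Timorin's
theorem (T4b `mixedHardLefschetz_of_pos_length`) is bounded below on the finite-dimensional space `Λ^{p,q}`.
[cite: DinhNguyen2006, §2 Prop. 2.2 (proof, (2.0)) and Prop. 2.1 (a) (arXiv PDF p. 5)] [cite: Timorin1998, Main Theorem] -/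
theorem exists_norm_sq_le_norm_wedgeFamily_wedge_sq_of_pos {r k p q : ℕ} (hg : finrank ℂ E = r + k) (hpq : p + q = k)
    {s : Fin r → E [⋀^Fin 2]→L[ℝ] ℝ} (hs : s ∈ positiveTuples E r) :
    ∃ C : ℝ, 0 < C ∧ ∀ A ∈ typeSubmodule E k p q,
      ‖A‖ ^ 2 ≤ C * ‖(wedgeFamily r fun j ↦ ofRealForm (-(s j))).wedge A‖ ^ 2 := by
  haveI : FiniteDimensional ℝ (E [⋀^Fin k]→L[ℝ] ℂ) := finiteDimensional_real_complexForms
  set V := (typeSubmodule E k p q).restrictScalars ℝ with hV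
  set Ω := wedgeFamily r fun j ↦ ofRealForm (-(s j)) with hΩ
  let L : ↥V →ₗ[ℝ] (E [⋀^Fin (2 * r + k)]→L[ℝ] ℂ) := (wedgeCLM ℝ E ℂ (2 * r) k Ω).toLinearMap.comp V.subtype
  have hL : ∀ x : ↥V, L x = Ω.wedge (x : E [⋀^Fin k]→L[ℝ] ℂ) := fun x ↦ by
    simp only [L, LinearMap.comp_apply, Submodule.subtype_apply, ContinuousLinearMap.coe_coe, wedgeCLM_apply]
  have hker : ∀ x : ↥V, L x = 0 → x = 0 := fun x hx ↦ by
    rw [hL] at hx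
    exact Subtype.ext (mixedHardLefschetz_of_pos_length hg hpq hs x.2 hx)
  obtain ⟨C, hC, h⟩ := exists_norm_sq_le_of_ker_eq_bot L hker
  refine ⟨C, hC, fun A hA ↦ ?_⟩
  have h' := h ⟨A, hA⟩
  rwa [hL] at h'

omit [FiniteDimensional ℂ E] in
/-- The upper half of (2.0) is the continuity of `∧`: `‖Ω ∧ A‖ ≤ ‖∧‖ ‖Ω‖ ‖A‖`.
[cite: DinhNguyen2006, §2 Prop. 2.2 (proof, (2.0)) (arXiv PDF p. 5)] [cite: WarnerGTM94, 2.6] -/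
theorem norm_wedge_le_opNorm_mul {a b : ℕ} (Ω : E [⋀^Fin a]→L[ℝ] ℂ) (A : E [⋀^Fin b]→L[ℝ] ℂ) :
    ‖Ω.wedge A‖ ≤ ‖wedgeCLM ℝ E ℂ a b‖ * ‖Ω‖ * ‖A‖ := by
  rw [← wedgeCLM_apply]
  exact (wedgeCLM ℝ E ℂ a b).le_opNorm₂ Ω A

end HardLefschetz

/-! ## §3 Dinh–Nguyên's Proposition 2.2 on a complex torus, every bidegree -/

section Estimate

variable {ι : Type*} [Fintype ι] [DecidableEq ι] {E : Type u} [NormedAddCommGroup E] [NormedSpace ℂ E]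
  (Φ : (ι → ℝ) ≃L[ℝ] E)

/-- **Mixed Hodge–Riemann as positivity of the real form `h`** (Prop. 2.1 (b) in the language of T4a's `hrForm`):
for a positive background `θ_0, …, θ_n` on the torus `X` of dimension `n + p + q` and a non-zero `A ∈ Λ^{p,q}` with
`(-θ_0)_ℂ ∧ ⋯ ∧ (-θ_n)_ℂ ∧ A = 0`: `h(A, A) = Re(ε(k,p,q) ∫_X (-θ_0)_ℂ ∧ ⋯ ∧ (-θ_{n-1})_ℂ ∧ A ∧ Ā) > 0` (T4b
`mixedHodgeRiemann_torusIntegral_pos` + `hrPairing_self_pos_iff`). [cite: DinhNguyen2006, §2 Prop. 2.1 (b) and §1 Thm. 1.3 (arXiv PDF pp. 3, 5)]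
[cite: Timorin1998, Main Theorem] -/
theorem hrForm_self_pos_of_pos {g n k p q : ℕ} (e : Fin (2 * g) ≃ ι) (hnk : n + k = g) (hpq : p + q = k)
    (h2 : 2 * n + (k + k) = 2 * g) {t : Fin (n + 1) → E [⋀^Fin 2]→L[ℝ] ℝ} (ht : t ∈ positiveTuples E (n + 1))
    {A : E [⋀^Fin k]→L[ℝ] ℂ} (hA : A ∈ typeSubmodule E k p q)
    (hprim : (wedgeFamily (n + 1) fun j ↦ ofRealForm (-(t j))).wedge A = 0) (hA0 : A ≠ 0) :
    0 < hrForm Φ e (hrSign k p q) (wedgeFamily n fun j ↦ ofRealForm (-(t (Fin.castSucc j)))) h2 A A := by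
  haveI := finiteDimensional_complex Φ
  subst hnk
  have hg : finrank ℂ E = n + k := finrank_eq_of_finTwoMulEquiv Φ e
  have h : 0 < hrPairing Φ e (hrSign k p q) (wedgeFamily n fun j ↦ ofRealForm (-(t (Fin.castSucc j)))) h2 A A :=
    mixedHodgeRiemann_torusIntegral_pos Φ e hg hpq h2 ht hA hprim hA0
  have hreal : conjForm (wedgeFamily n fun j ↦ ofRealForm (-(t (Fin.castSucc j)))) =
      wedgeFamily n fun j ↦ ofRealForm (-(t (Fin.castSucc j))) :=
    conjForm_wedgeFamily_of_real (conjForm_ofRealForm_neg_family fun j ↦ t (Fin.castSucc j))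
  exact (hrPairing_self_pos_iff Φ e _ _ h2 hreal (conj_hrSign hpq) A).1 h

/-- **Dinh–Nguyên's Proposition 2.2 on a complex torus, every bidegree `(p, q)`.** For positive real `(1,1)`-forms
`θ_0, …, θ_n` on `X = E/Φ(ℤ^ι)` of dimension `g = n + p + q` there are constants `C₁, C₂ > 0` such that
**`‖A‖² ≤ C₁ ‖(-θ_0)_ℂ ∧ ⋯ ∧ (-θ_n)_ℂ ∧ A‖² + C₂ h(A, A)`** for every form `A` of type `(p, q)`, where
`h(A, A) = Re(ε(k,p,q) ∫_X (-θ_0)_ℂ ∧ ⋯ ∧ (-θ_{n-1})_ℂ ∧ A ∧ Ā)` ("There are finite positive constants `C₁` and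
`C₂` such that `C₁ ‖α ∧ Ω ∧ ω_{n-p-q+1}‖² + C₂ Re Q(α, α) ≥ ‖α‖²` for all forms `α ∈ Λ^{p,q}(ℂⁿ)`"; any norm on the
finite-dimensional space `Λ^{p,q}` — here the operator norm of the tree). Proof: the compactness lemma of §1 with
`L = Ω_{n+1} ∧ ·` on `Λ^{p,q}` and `B = h`, positive on `ker L ∖ 0` by the mixed Hodge–Riemann relations
(`hrForm_self_pos_of_pos`); Dinh–Nguyên argue instead through the decomposition `α = β + ω ∧ γ` and the two-sided
estimate (2.0). [cite: DinhNguyen2006, §2 Prop. 2.2 (arXiv PDF p. 5)] [cite: Timorin1998, Main Theorem]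
[cite: Finsler1937, pp. 188–192] -/
theorem exists_norm_sq_le_of_pos {g n k p q : ℕ} (e : Fin (2 * g) ≃ ι) (hnk : n + k = g) (hpq : p + q = k)
    (h2 : 2 * n + (k + k) = 2 * g) {t : Fin (n + 1) → E [⋀^Fin 2]→L[ℝ] ℝ} (ht : t ∈ positiveTuples E (n + 1)) :
    ∃ C₁ C₂ : ℝ, 0 < C₁ ∧ 0 < C₂ ∧ ∀ A ∈ typeSubmodule E k p q,
      ‖A‖ ^ 2 ≤ C₁ * ‖(wedgeFamily (n + 1) fun j ↦ ofRealForm (-(t j))).wedge A‖ ^ 2 +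
        C₂ * hrForm Φ e (hrSign k p q) (wedgeFamily n fun j ↦ ofRealForm (-(t (Fin.castSucc j)))) h2 A A := by
  haveI := finiteDimensional_complex Φ
  haveI : FiniteDimensional ℝ (E [⋀^Fin k]→L[ℝ] ℂ) := finiteDimensional_real_complexForms
  set V := (typeSubmodule E k p q).restrictScalars ℝ with hV
  set Ω₁ := wedgeFamily (n + 1) fun j ↦ ofRealForm (-(t j)) with hΩ₁
  let L : ↥V →ₗ[ℝ] (E [⋀^Fin (2 * (n + 1) + k)]→L[ℝ] ℂ) :=
    (wedgeCLM ℝ E ℂ (2 * (n + 1)) k Ω₁).toLinearMap.comp V.subtype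
  have hL : ∀ x : ↥V, L x = Ω₁.wedge (x : E [⋀^Fin k]→L[ℝ] ℂ) := fun x ↦ by
    simp only [L, LinearMap.comp_apply, Submodule.subtype_apply, ContinuousLinearMap.coe_coe, wedgeCLM_apply]
  set B := hrFormPQ Φ e (hrSign k p q) (wedgeFamily n fun j ↦ ofRealForm (-(t (Fin.castSucc j)))) h2 p q with hB
  have hpos : ∀ x : ↥V, L x = 0 → x ≠ 0 → 0 < B x x := by
    intro x hx hx0
    rw [hL] at hx
    have hA0 : (x : E [⋀^Fin k]→L[ℝ] ℂ) ≠ 0 := fun h ↦ hx0 (Subtype.ext h)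
    have h := hrForm_self_pos_of_pos Φ e hnk hpq h2 ht x.2 hx hA0
    rwa [hB, hrFormPQ_apply, ← hrForm_apply]
  obtain ⟨C₁, C₂, hC₁, hC₂, h⟩ := exists_norm_sq_le_of_pos_on_ker B L hpos
  refine ⟨C₁, C₂, hC₁, hC₂, fun A hA ↦ ?_⟩
  have h' := h ⟨A, hA⟩
  rw [hL, hB, hrFormPQ_apply, ← hrForm_apply] at h'
  exact h'

/-- **Coercivity of the mixed Hodge–Riemann form on the mixed primitive forms**: with `θ_j`, `C₂` as above,
`‖A‖² ≤ C₂ h(A, A)` for every `A ∈ Λ^{p,q}` with `(-θ_0)_ℂ ∧ ⋯ ∧ (-θ_n)_ℂ ∧ A = 0` (Dinh–Nguyên's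
"`‖β‖² ≤ C'' Q(β, β)`", Prop. 2.1 (b) made quantitative). [cite: DinhNguyen2006, §2 Prop. 2.2 (proof) and Prop. 2.1 (b) (arXiv PDF p. 5)]
[cite: Timorin1998, Main Theorem] -/
theorem exists_norm_sq_le_hrForm_of_pos {g n k p q : ℕ} (e : Fin (2 * g) ≃ ι) (hnk : n + k = g) (hpq : p + q = k)
    (h2 : 2 * n + (k + k) = 2 * g) {t : Fin (n + 1) → E [⋀^Fin 2]→L[ℝ] ℝ} (ht : t ∈ positiveTuples E (n + 1)) :
    ∃ C : ℝ, 0 < C ∧ ∀ A ∈ typeSubmodule E k p q, (wedgeFamily (n + 1) fun j ↦ ofRealForm (-(t j))).wedge A = 0 →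
      ‖A‖ ^ 2 ≤ C * hrForm Φ e (hrSign k p q) (wedgeFamily n fun j ↦ ofRealForm (-(t (Fin.castSucc j)))) h2 A A := by
  obtain ⟨C₁, C₂, -, hC₂, h⟩ := exists_norm_sq_le_of_pos Φ e hnk hpq h2 ht
  refine ⟨C₂, hC₂, fun A hA hprim ↦ ?_⟩
  have h' := h A hA
  rwa [hprim, norm_zero, zero_pow two_ne_zero, mul_zero, zero_add] at h'

/-- The estimate with the complex pairing `H(A, A) = ε ∫_X Ω ∧ A ∧ Ā` (a real number) in place of its real part.
[cite: DinhNguyen2006, §2 Prop. 2.2 (arXiv PDF p. 5)] -/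
theorem exists_norm_sq_le_of_pos' {g n k p q : ℕ} (e : Fin (2 * g) ≃ ι) (hnk : n + k = g) (hpq : p + q = k)
    (h2 : 2 * n + (k + k) = 2 * g) {t : Fin (n + 1) → E [⋀^Fin 2]→L[ℝ] ℝ} (ht : t ∈ positiveTuples E (n + 1)) :
    ∃ C₁ C₂ : ℝ, 0 < C₁ ∧ 0 < C₂ ∧ ∀ A ∈ typeSubmodule E k p q,
      ((‖A‖ ^ 2 : ℝ) : ℂ) ≤ C₁ * ((‖(wedgeFamily (n + 1) fun j ↦ ofRealForm (-(t j))).wedge A‖ ^ 2 : ℝ) : ℂ) +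
        C₂ * hrPairing Φ e (hrSign k p q) (wedgeFamily n fun j ↦ ofRealForm (-(t (Fin.castSucc j)))) h2 A A := by
  haveI := finiteDimensional_complex Φ
  obtain ⟨C₁, C₂, hC₁, hC₂, h⟩ := exists_norm_sq_le_of_pos Φ e hnk hpq h2 ht
  refine ⟨C₁, C₂, hC₁, hC₂, fun A hA ↦ ?_⟩
  have hreal : conjForm (wedgeFamily n fun j ↦ ofRealForm (-(t (Fin.castSucc j)))) =
      wedgeFamily n fun j ↦ ofRealForm (-(t (Fin.castSucc j))) :=
    conjForm_wedgeFamily_of_real (conjForm_ofRealForm_neg_family fun j ↦ t (Fin.castSucc j))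
  rw [hrPairing_self_eq Φ e _ _ h2 hreal (conj_hrSign hpq) A]
  have h' := h A hA
  rw [hrForm_apply] at h' ⊢
  exact_mod_cast h'

end Estimate

end ComplexTorus

end Literature.Geometry.Kaehler

end
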